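import Summits.BirchSwinnertonDyer.Rank1Residual.Additive.SharpenedStatements
import Summits.BirchSwinnertonDyer.Rank1Residual.O5.ThreeTorsionNormalFormKummer
import Summits.BirchSwinnertonDyer.Rank1Residual.O5.ThreeTorsionNormalFormValuation
import HarnessLib

/-!
# O5 — GEN 13: the FLEX NORMAL FORM `y² + 3b·xy + 3ᵃA₃·y = x³` at `3` and the law T30 —
# (Kodaira, c₃, v₃Δ, f₃, k, t) of EVERY class-01 curve over `ℚ₃` as a function of (a, b mod 3, A₃ mod 9, v₃(b³ − A₃), two residues)

Add-on to GEN 12's `O5RationalTorsionCostLaw` (T29; typing ask A-O5-27, cc-typer-5) and to the tree TOOL file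
`O5/ThreeTorsionNormalFormKummer.lean` (x11b3-p7 GEN 13, p308301: cubes in `ℚ₃`, the unit half END-3/END-4).
Census cell O5 = (t′) ∪ wild, o5-r1 GEN 13 (planner-b2b-bsdres-o5-r1-g13-0, 2026-08-21).  Informal text of record:
`HOME/b2b-bsdres-o5-r1/gen13/T30-FLAT-KUMMER-NORMAL-FORM.md` (§1: Lemma 0, T30.1–T30.7 with proofs); pre-registration
`gen13/P-K19-PREREG.md` (sha16 29ea23ef8cc75c6f, frozen 22:40Z before any run; frozen scorer `pk19/score19.py`
21d36208e1c08241); census P-K19 = kit job j142073 (343 472 class-01 rows out of all 923 952 Cremona curves with `9 ∣ N`,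
`N < 500 000`; 0 errors; every theorem-check 0 exceptions).

HONEST FRAMING (cell `b2b-bsdres`): research route, lane CLASS-CLOSURE (`CLASS-CLOSURE-PLAN.md` §3.5 O5).  §1 below is
PROVED algebra (Mathlib `ring` identities about the one Weierstrass equation; no curve-theoretic claim); §2 is a COMPUTABLE
predictor (pure function, `decide` examples); §3 states the law as `def … : Prop` nodes tagged `@[conjecture]`
(THEOREM-CANDIDATES: each has a written proof in T30 §1 by Tate's algorithm + the 3-isogeny Kummer map, and is validated
by P-K19 with 0 exceptions) plus ONE proved link to the tree (`exists_point_not_cube_of_emod_nine`, from p308301).  Nothing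
is asserted, nothing booked, no mark of `RESIDUAL-MAP.md` moves, NO Literature fact is minted; census numbers are EVIDENCE;
no main conjecture, no `L`-value, no Selmer group and no class group enters any computation or any node.

## The statement in one paragraph (T30)
Every `E/ℚ₃` with a `ℚ₃`-rational point `P₀` of order `3` has a `3`-MINIMAL flex model `y² + 3b·xy + 3ᵃA₃·y = x³`
(`P₀ = (0,0)`, tangent `y = 0`; `b ∈ ℤ₃`, `A₃ ∈ ℤ₃^×`, `a ∈ {0,1,2}`; for `a = 0` normalise `A₃ ≡ 1 (mod 3)` by `y ↦ −y`)
and the local `φ̂`-Kummer map of `φ : E → E′ = E/⟨P₀⟩` is `δ(P) = y(P) · ℚ₃^{×3}` (Lemma 0: `y ∘ φ̂ = (−h/α)³` exactly, no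
cube-class constant).  CASE N (`a = 0`, i.e. `P₀` non-singular mod 3; write `b₃ = b mod 3`, `a₉ = A₃ mod 9 ∈ {1,4,7}`,
`w = v₃(b³ − A₃)`, `m = (3b − 2 − A₃)/9`, `g = (b³ − A₃)/27`): `v₃Δ = 3 + w`; `b₃ ∈ {0,2}`: type III (`c = 2`, `f = 2`)
iff `(b₃,a₉) ∈ {(0,7),(2,4)}`, else II (`c = 1`, `f = 3`); `b₃ = 1, a₉ ≠ 1`: II, `v₃Δ = 4`, `f = 4`; `(b₃,a₉) = (1,1)`:
`w = 2` ⇒ IV (`f = 3`; `c = 3` iff `m ≡ 1`, `c = 1` iff `m ≡ 2 (mod 3)`), `w = 3` ⇒ I₀* (`c = 1` iff `g ≡ 1`, `c = 2` iff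
`g ≡ 2`), `w ≥ 4` ⇒ I*_{w−3} (`c ∈ {2,4}`); and `(k, t) = (1, U)` (the flat line) iff `a₉ ≠ 1` or the cell is IV with
`c = 3`, else `(0, 0)` — in particular (T29.6, now a theorem on paper) EVERY class-01 type-III curve has `(k,t) = (1,U)`.
CASE S (`a ∈ {1,2}`, `P₀` singular mod 3): `a = 1` ⇒ IV, `c = 3`, `v₃Δ = 7` if `3 ∣ b` else `6`, `(k,t) = (1, ⟨[3A₃]⟩)`
(a très ramifié line) iff `b₃ = 2`, else `(2, plane)`; `a = 2` ⇒ IV*, `c = 3`, `v₃Δ = 11` if `3 ∣ b` else `9`,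
`(k,t) = (1, ⟨[9A₃]⟩)` iff `b₃ = 0`, else `(2, plane)`.  Types Iₙ, III*, II* never carry a rational 3-torsion point with
non-split `E[3]`; IV* occurs only in Case S.  Census P-K19: all 17 cells pure, 0 exceptions on 343 472 curves.

## TYPER PLACEMENT NOTE (cc-typer-5 GEN 10 = O5 §3.5 / O6 §3.4 typer of record; ask A-O5-28 of o5-r1 GEN 13, `HOME/INBOX.md` 2026-08-21T23:18Z: "land it as `O5/O5FlatKummerNormalForm.lean` …; once FILE V is in the tree add the link `NFKummerFlat b A₃ 0` ⇐ …")

HONEST FRAMING as above (research route; §3 nodes are `@[conjecture] def … : Prop`, EVIDENCE-labelled; census P-K19 = EVIDENCE, never a Literature fact; nothing asserted / booked; no mark of `RESIDUAL-MAP.md` moves; NO Literature fact minted; O5 OPEN). PROVENANCE: module text above this note and every declaration of §1–§3 = o5-r1 GEN 13's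
`HOME/b2b-bsdres-o5-r1/gen13/O5FlatKummerNormalForm.lean` (sha16 `471d0d5b5b5a64cc`, 345 l.; write-up `gen13/T30-FLAT-KUMMER-NORMAL-FORM.md`; prereg `gen13/P-K19-PREREG.md` 29ea23ef8cc75c6f, scorer 21d36208e1c08241, kit j142073), BYTE-IDENTICAL in every declaration; typer changes (+ five one-line docstrings on `nf_a₁…a₆`, gate `lint.docstring`): (i) `import …
O5.ThreeTorsionNormalFormValuation` (x11b3-p7 GEN 15's FILE V, p309383); (ii) TWO CITE KEYS corrected in docstrings, locators unchanged: `Kozuma2025SingularThreeTorsion` ↦ `GajovicRadicevicVerzobio2025` (arXiv:2502.08583 = S. Gajović, L. Radičević, M. Verzobio 2025; pages re-read, Lemmas 52–53 / Thm 55 on pp. 19–21; the draft key's author was a slip) and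
`Schaefer1996ClassGroupsSelmer` ↦ the tree's `Schaefer1996` (same paper); bib entries `GajovicRadicevicVerzobio2025`, `CohenPazuki2009ThreeDescent`, `DokchitserDokchitser2015LocalInvariantsIsogenous`, `BKLS2019ThreeIsogenySelmer` ADDED; (iii) the appendix §T (OUTSIDE o5-r1's text): the asked LINK `nfKummerFlat_zero : ¬ 3 ∣ A₃ → NFKummerFlat b A₃ 0` (FILE V's
`ne_zero_and_three_dvd_valuation` at `a₁ = 3b`, `a₃ = A₃`), `nfKummerHasUnit_zero_of_emod_nine`, and the PROVED cell law `nfKummer_flatUnit_of_emod_nine : A₃ ≡ 1 (3) → A₃ ≢ 1 (9) → NFKummerFlat b A₃ 0 ∧ NFKummerHasUnit b A₃ 0` — the `(1,U)` conclusion on EVERY Case-N cell with `a₉ ≠ 1` (III, II `v₃Δ ∈ {3,4}`), unconditionally; `FlexNFTypeIIIFlatUnitThree` is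
thereby reduced to T30.4's "type III ⇒ `a₉ ≠ 1`". ORDER: filed while A-O5-26 (p310242) is in review and before A-O5-27 — this file imports neither. o5-r1's DEDUP remark recorded as a READING: for `W/ℚ` whose base change IS a flex normal form with `P₀ = (0,0)` (`y₀ = m₀ = 0`), A-O5-27's `HasFlatLineKummerImageAtThree W` reads `NFKummerFlat ∧ NFKummerHasUnit`;
no bridge lemma (different quantified objects). DEDUP (tree grep, all §1–§3 names + `FlexNormalForm.*`): no match. CHECK: farm `lean check` rc 0 / 0 warnings / 0 sorries; axioms standard. STATUS ⟦cc-typer-5 GEN 16 (c28) + GEN 17 (c30b) + (r1)⟧: T30.4 (v1) REFUTED AS TYPED on the `ord3 64` fuel artefact (n1011-p18; negative edge p333659 ACCEPTED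
`FlexNormalForm.not_flexNFCaseNKodairaLawThree`) and SUPERSEDED by the v2 node `FlexNFCaseNKodairaValLawThree` of the sibling `O5/FlexNormalFormCaseNValLaw.lean` (true valuation via `cellNAt`); T30.5 PROVED AS TYPED (p332637 `flexNFCaseSKodairaLawThree_holds`); T30.6 (v1) REFUTED AS TYPED on the missing sign normalisation of T30.1 (f) (n1011-p18 GEN 14;
negative edge p338343 `FlexNormalForm.not_flexNFCaseSKummerLawThree`, witness (a, b, A₃) = (1, 2, 2)) and SUPERSEDED by the v2 node `FlexNFCaseSKummerSignedLawThree` of the sibling `O5/FlexNormalFormCaseSSignedLaw.lean` (p336580; binder `A₃ % 3 = 1`); T29.6 NF `FlexNFTypeIIIFlatUnitThree` PROVED AS TYPED (n1011-p18 GEN 14 `flexNFTypeIIIFlatUnitThree_holds`,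
`O5/FlexNFTypeIIIFlatUnitThreeProofs.lean` p337515); the four `@[conjecture]` attributes dropped here, statement bytes unchanged; `FlexNFCaseNKummerLawThree` untouched (the one open node). STATUS ⟦cc-typer-5 GEN 18, rider (r9)⟧: `FlexNFCaseNKummerLawThree` PROVED AS TYPED (n1011-p18 GEN 16 `flexNFCaseNKummerLawThree_holds`, `O5/FlexNFCaseNKummerLawThreeProofs.lean` p345238; unit half p342951) — its `@[conjecture]` attribute dropped, statement bytes unchanged; every §3 node of this file is now a THEOREM or a settled negative edge; `@[conjecture]` × 0 (the typer's two-line placement-note heading above joined into one line to keep the file at its `lint.size` line count).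
-/

open WeierstrassCurve Literature.NumberTheory.DiophantineGeometry

namespace Summit.BirchSwinnertonDyer.Rank1Residual.O5.FlexNormalForm

/-! ## §1 Proved algebra of the flex normal form (any commutative ring) -/

section Algebra

variable {R : Type*} [CommRing R]

/-- The flex normal form `y² + A₁xy + A₃y = x³` (`P₀ = (0,0)` of order `3`, tangent line `y = 0`). [folklore] -/
def nf (A₁ A₃ : R) : WeierstrassCurve R := ⟨A₁, 0, A₃, 0, 0⟩

/-- `a₁ = A₁`. [folklore] -/ @[simp] theorem nf_a₁ (A₁ A₃ : R) : (nf A₁ A₃).a₁ = A₁ := rfl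
/-- `a₂ = 0`. [folklore] -/ @[simp] theorem nf_a₂ (A₁ A₃ : R) : (nf A₁ A₃).a₂ = 0 := rfl
/-- `a₃ = A₃`. [folklore] -/ @[simp] theorem nf_a₃ (A₁ A₃ : R) : (nf A₁ A₃).a₃ = A₃ := rfl
/-- `a₄ = 0`. [folklore] -/ @[simp] theorem nf_a₄ (A₁ A₃ : R) : (nf A₁ A₃).a₄ = 0 := rfl
/-- `a₆ = 0`. [folklore] -/ @[simp] theorem nf_a₆ (A₁ A₃ : R) : (nf A₁ A₃).a₆ = 0 := rfl

/-- `b₂ = A₁²`. [folklore] -/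
theorem nf_b₂ (A₁ A₃ : R) : (nf A₁ A₃).b₂ = A₁ ^ 2 := by simp [b₂]
/-- `b₄ = A₁A₃`. [folklore] -/
theorem nf_b₄ (A₁ A₃ : R) : (nf A₁ A₃).b₄ = A₁ * A₃ := by simp [b₄]
/-- `b₆ = A₃²`. [folklore] -/
theorem nf_b₆ (A₁ A₃ : R) : (nf A₁ A₃).b₆ = A₃ ^ 2 := by simp [b₆]
/-- `b₈ = 0` (the flex condition). [folklore] -/
theorem nf_b₈ (A₁ A₃ : R) : (nf A₁ A₃).b₈ = 0 := by simp [b₈]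
/-- `c₄ = A₁(A₁³ − 24A₃)`. [folklore] -/
theorem nf_c₄ (A₁ A₃ : R) : (nf A₁ A₃).c₄ = A₁ * (A₁ ^ 3 - 24 * A₃) := by
  simp [c₄, b₂, b₄]; ring
/-- `c₆ = −A₁⁶ + 36A₁³A₃ − 216A₃²`. [folklore] -/
theorem nf_c₆ (A₁ A₃ : R) : (nf A₁ A₃).c₆ = -(A₁ ^ 6) + 36 * A₁ ^ 3 * A₃ - 216 * A₃ ^ 2 := by
  simp [c₆, b₂, b₄, b₆]; ring
/-- `Δ = A₃³(A₁³ − 27A₃)`. [folklore] -/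
theorem nf_Δ (A₁ A₃ : R) : (nf A₁ A₃).Δ = A₃ ^ 3 * (A₁ ^ 3 - 27 * A₃) := by
  simp [Δ, b₂, b₄, b₆, b₈]; ring
/-- With `A₁ = 3b`: `Δ = 27·A₃³·(b³ − A₃)`, so `v₃Δ = 3 + 3v₃(A₃) + v₃(b³ − A₃)`. [folklore] -/
theorem nf_Δ_three (b A₃ : R) : (nf (3 * b) A₃).Δ = 27 * A₃ ^ 3 * (b ^ 3 - A₃) := by
  rw [nf_Δ]; ring
/-- With `A₁ = 3b`: `c₄ = 9b(9b³ − 8A₃)` (so `v₃c₄ = 2 + v₃ b` for a unit `A₃`). [folklore] -/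
theorem nf_c₄_three (b A₃ : R) : (nf (3 * b) A₃).c₄ = 9 * b * (9 * b ^ 3 - 8 * A₃) := by
  rw [nf_c₄]; ring
/-- The residue identity behind `w = v₃(b³ − A₃)` in the cusp cell: `b³ − A₃ = (b−1)²(b+2) + (3b − 2 − A₃)`. [folklore] -/
theorem cube_sub_eq (b A₃ : R) : b ^ 3 - A₃ = (b - 1) ^ 2 * (b + 2) + (3 * b - 2 - A₃) := by ring

/-- The TRANSLATED model `[u, r, s, t] = [1, −1, 0, 1]` of `nf (3b) A₃` (Case N, cell `b ≡ 1, A₃ ≡ 1 (mod 3)`: it moves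
the cusp `(−1, 1)` of the reduction to the origin; `u := A₃ − 3b + 2`):
`a₁′ = 3b, a₂′ = −3, a₃′ = u, a₄′ = 3(1 − b), a₆′ = −u`. [folklore] -/
def nfT (b A₃ : R) : WeierstrassCurve R := ⟨3 * b, -3, A₃ - 3 * b + 2, 3 * (1 - b), -(A₃ - 3 * b + 2)⟩

/-- The translation is Mathlib's variable change `⟨1, −1, 0, 1⟩`. [folklore] -/
theorem smul_nf_eq_nfT (b A₃ : R) : (⟨1, -1, 0, 1⟩ : VariableChange R) • nf (3 * b) A₃ = nfT b A₃ := by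
  ext <;> simp [variableChange_def, nf, nfT] <;> ring

/-- `b₂′ = 3(3b² − 4)`. [folklore] -/
theorem nfT_b₂ (b A₃ : R) : (nfT b A₃).b₂ = 3 * (3 * b ^ 2 - 4) := by simp [b₂, nfT]; ring
/-- `b₆′ = u(u − 4)`, `u = A₃ − 3b + 2` (Tate step 5/6 reads `b₆′ mod 27`). [folklore] -/
theorem nfT_b₆ (b A₃ : R) :
    (nfT b A₃).b₆ = (A₃ - 3 * b + 2) * ((A₃ - 3 * b + 2) - 4) := by simp [b₆, nfT]; ring
/-- `b₈′ = u(12 − 9b) − 3u² − 9(1 − b)²` (Tate step 4 reads `b₈′ mod 27`). [folklore] -/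
theorem nfT_b₈ (b A₃ : R) :
    (nfT b A₃).b₈ = (A₃ - 3 * b + 2) * (12 - 9 * b) - 3 * (A₃ - 3 * b + 2) ^ 2 - 9 * (1 - b) ^ 2 := by
  simp [b₈, nfT]; ring
/-- `Δ′ = Δ` (the change has `u = 1`). [folklore] -/
theorem nfT_Δ (b A₃ : R) : (nfT b A₃).Δ = 27 * A₃ ^ 3 * (b ^ 3 - A₃) := by
  simp [Δ, b₂, b₄, b₆, b₈, nfT]; ring

/-- The affine equation as one polynomial value: `y² + a₁xy + a₃y − (x³ + a₂x² + a₄x + a₆)`. [folklore] -/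
def eqnValue (W : WeierstrassCurve R) (x y : R) : R :=
  y ^ 2 + W.a₁ * x * y + W.a₃ * y - (x ^ 3 + W.a₂ * x ^ 2 + W.a₄ * x + W.a₆)

/-- AMENDMENT A1's expansion at the cusp `(−1, 1)`: for `x = −1 + 3ξ`, `y = 1 + 3η`,
`F = 9η² + (2 − 3b + A₃)(1 + 3η) + 9(b − 1)ξ + 27(ξ² − ξ³ + bξη)`; with `b ≡ 1 (3)`, `A₃ = 3b − 2 + 9m` this is
`9(η² − m) (mod 27)`, so a `ℤ₃`-point over the cusp exists iff `m` is a square mod 3, and then `y ≡ 4, 7 (mod 9)`. [folklore] -/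
theorem eqnValue_nf_cusp (b A₃ ξ η : R) :
    eqnValue (nf (3 * b) A₃) (-1 + 3 * ξ) (1 + 3 * η) =
      9 * η ^ 2 + (2 - 3 * b + A₃) * (1 + 3 * η) + 9 * (b - 1) * ξ + 27 * (ξ ^ 2 - ξ ^ 3 + b * ξ * η) := by
  simp [eqnValue, nf]; ring

/-- The sign normalisation: `(x, y) ↦ (x, −y)` carries `nf A₁ A₃` to `nf (−A₁) (−A₃)` (equation values agree up to the
substitution), so in Case N one may assume `A₃ ≡ 1 (mod 3)`. [folklore] -/
theorem eqnValue_nf_neg (A₁ A₃ x y : R) : eqnValue (nf (-A₁) (-A₃)) x (-y) = eqnValue (nf A₁ A₃) x y := by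
  simp only [eqnValue, nf]; ring

end Algebra

/-! ## §2 The computable cell predictor (T30.4 / T30.5 as a pure function; `decide` examples) -/

/-- Fuel-bounded `3`-adic order of an integer (`ord3 n 0 = n`-junk; fuel `64` suffices for `|x| < 3⁶⁴`). [folklore] -/
def ord3 : ℕ → ℤ → ℕ
  | 0, _ => 0
  | n + 1, x => if x ≠ 0 ∧ x % 3 = 0 then ord3 n (x / 3) + 1 else 0

/-- The Kummer-image class `t ⊂ ℚ₃^×/ℚ₃^{×3}` of a cell: `O` = trivial (`k = 0`), `U` = the flat (unit) line,
`L` = the très ramifié line `⟨[3ᵃA₃]⟩` (Case S only), `P` = the whole plane (`k = 2`). [folklore] -/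
inductive TCls
  | O | U | L | P
  deriving DecidableEq, Repr, Inhabited

/-- One cell of the law: Kodaira symbol, Tamagawa number `c₃` (`none` = `2 or 4`, undetermined by these residues: `Iₙ*`),
`v₃(Δ_min)`, conductor exponent `f₃`, `k = dim E(ℚ₃)/φ̂E′(ℚ₃)`, and the class `t`. [folklore] -/
structure Cell where
  kod : KodairaSymbol
  c : Option ℕ
  vD : ℕ
  f : ℕ
  k : ℕ
  t : TCls
  deriving DecidableEq, Repr

/-- Ogg's formula at an additive place: `f = v(Δ_min) + 1 − m`. [folklore] -/
def oggF (K : KodairaSymbol) (vD : ℕ) : ℕ := vD + 1 - K.numComponents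

/-- **T30.4 as a function (Case N: `a = 0`, `A₃ ≡ 1 (mod 3)`, `A₁ = 3b`).**  Inputs `b, A₃ ∈ ℤ`; output the cell; ERRATUM (c28): `w`
reads the FUEL-BOUNDED `ord3 64` = min(v₃, 64) — the uncapped predictor is `cellNAt` (`O5/FlexNormalFormCaseNValLaw.lean`). Junk outside the hypotheses. [folklore] -/
def cellN (b A₃ : ℤ) : Cell :=
  let b3 := b % 3
  let a9 := A₃ % 9
  if b3 ≠ 1 then
    (if (b3 = 0 ∧ a9 = 7) ∨ (b3 = 2 ∧ a9 = 4) then ⟨.III, some 2, 3, oggF .III 3, 1, .U⟩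
      else ⟨.II, some 1, 3, oggF .II 3, (if a9 = 1 then 0 else 1), (if a9 = 1 then .O else .U)⟩)
  else if a9 ≠ 1 then ⟨.II, some 1, 4, oggF .II 4, 1, .U⟩
  else
    let w := ord3 64 (b ^ 3 - A₃)
    let m := (3 * b - 2 - A₃) / 9
    let g := (b ^ 3 - A₃) / 27
    if w = 2 then
      (if m % 3 = 1 then ⟨.IV, some 3, 5, oggF .IV 5, 1, .U⟩ else ⟨.IV, some 1, 5, oggF .IV 5, 0, .O⟩)
    else if w = 3 then ⟨.Istar 0, some (if g % 3 = 1 then 1 else 2), 6, oggF (.Istar 0) 6, 0, .O⟩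
    else ⟨.Istar (w - 3), none, w + 3, oggF (.Istar (w - 3)) (w + 3), 0, .O⟩

/-- **T30.5 as a function (Case S: `a = v₃(a₃) ∈ {1, 2}`, `A₁ = 3b`, `A₃` a unit).** [folklore] -/
def cellS (a : ℕ) (b : ℤ) : Cell :=
  let b3 := b % 3
  if a = 1 then
    ⟨.IV, some 3, (if b3 = 0 then 7 else 6), oggF .IV (if b3 = 0 then 7 else 6),
      (if b3 = 2 then 1 else 2), (if b3 = 2 then .L else .P)⟩
  else
    ⟨.IVstar, some 3, (if b3 = 0 then 11 else 9), oggF .IVstar (if b3 = 0 then 11 else 9),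
      (if b3 = 0 then 1 else 2), (if b3 = 0 then .L else .P)⟩

/-! ### The 17 observed cells (census P-K19, j142073; counts in the comments), one representative each -/

example : cellN 0 7 = ⟨.III, some 2, 3, 2, 1, .U⟩ := by decide        -- III (1,U): 27 224 (with (2,4))
example : cellN 2 4 = ⟨.III, some 2, 3, 2, 1, .U⟩ := by decide
example : cellN 0 1 = ⟨.II, some 1, 3, 3, 0, .O⟩ := by decide         -- II v₃Δ=3 (0,0): 8 537
example : cellN 0 4 = ⟨.II, some 1, 3, 3, 1, .U⟩ := by decide         -- II v₃Δ=3 (1,U): 8 363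
example : cellN 2 7 = ⟨.II, some 1, 3, 3, 1, .U⟩ := by decide
example : cellN 1 4 = ⟨.II, some 1, 4, 4, 1, .U⟩ := by decide         -- II v₃Δ=4 (1,U): 7 590
example : cellN 4 1 = ⟨.IV, some 3, 5, 3, 1, .U⟩ := by decide         -- IV c=3 (1,U): 8 276  (w=2, m=1)
example : cellN 1 10 = ⟨.IV, some 1, 5, 3, 0, .O⟩ := by decide        -- IV c=1 (0,0): 8 059  (w=2, m≡2)
example : cellN 1 (-26) = ⟨.Istar 0, some 1, 6, 2, 0, .O⟩ := by decide -- I₀* c=1 (0,0): 16 443 (g=1)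
example : cellN 1 (-53) = ⟨.Istar 0, some 2, 6, 2, 0, .O⟩ := by decide -- I₀* c=2 (0,0): 22 411 (g=2)
example : cellN 1 (-80) = ⟨.Istar 1, none, 7, 2, 0, .O⟩ := by decide   -- Iₙ* (0,0): 216 173 (n ≤ 56)
example : cellN 1 (-242) = ⟨.Istar 2, none, 8, 2, 0, .O⟩ := by decide
example : cellS 1 0 = ⟨.IV, some 3, 7, 5, 2, .P⟩ := by decide         -- IV v₃Δ=7 (2,P): 2 412
example : cellS 1 1 = ⟨.IV, some 3, 6, 4, 2, .P⟩ := by decide         -- IV v₃Δ=6 (2,P): 2 665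
example : cellS 1 2 = ⟨.IV, some 3, 6, 4, 1, .L⟩ := by decide         -- IV v₃Δ=6 (1,L): 2 659
example : cellS 2 0 = ⟨.IVstar, some 3, 11, 5, 1, .L⟩ := by decide    -- IV* v₃Δ=11 (1,L): 3 580
example : cellS 2 1 = ⟨.IVstar, some 3, 9, 3, 2, .P⟩ := by decide     -- IV* v₃Δ=9 (2,P): 9 080

/-- In Case N the predictor puts `(k, t) = (1, U)` on every type-III cell (T29.6 at the level of the function). [folklore] -/
theorem cellN_k_of_kod_eq_III (b A₃ : ℤ) (h : (cellN b A₃).kod = .III) :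
    (cellN b A₃).k = 1 ∧ (cellN b A₃).t = .U := by
  unfold cellN at h ⊢
  simp only at h ⊢
  (split_ifs at h ⊢; simp_all)

/-- In Case N the predictor never outputs `k = 2`, and `t = U` exactly when `k = 1` (flatness, T30.2). [folklore] -/
theorem cellN_t_eq (b A₃ : ℤ) : (cellN b A₃).t = (if (cellN b A₃).k = 1 then .U else .O) ∧ (cellN b A₃).k ≤ 1 := by
  unfold cellN
  simp only
  split_ifs <;> simp_all

/-! ## §3 The law as `Prop` nodes over the tree's objects, and one proved link to p308301 -/

section Law

open Summit.BirchSwinnertonDyer.Rank1Residual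

/-- The flex normal form over `ℚ₃` with `A₁ = 3b`, `a₃ = 3ᵃA₃`: the affine equation at `(x, y)`. [folklore] -/
def OnNF (b A₃ : ℤ) (a : ℕ) (x y : ℚ_[3]) : Prop :=
  y ^ 2 + 3 * (b : ℚ_[3]) * x * y + (3 : ℚ_[3]) ^ a * (A₃ : ℚ_[3]) * y = x ^ 3

/-- The same curve over `ℚ` (input to the tree's `kodairaSymbolAt` / `conductorExponent` at `placeOf 3`). [folklore] -/
def nfQ (b A₃ : ℤ) (a : ℕ) : WeierstrassCurve ℚ := nf (3 * (b : ℚ)) ((3 : ℚ) ^ a * (A₃ : ℚ))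

/-- `t ⊆ U`: every point with `x ≠ 0` has `y ≠ 0` and `3 ∣ v₃(y)` (by Lemma 0, `δ(P) = [y(P)]`). [folklore] -/
def NFKummerFlat (b A₃ : ℤ) (a : ℕ) : Prop :=
  ∀ x y : ℚ_[3], OnNF b A₃ a x y → x ≠ 0 → y ≠ 0 ∧ (3 : ℤ) ∣ Padic.valuation y

/-- `t ∋` a unit class: some point with `x ≠ 0` has a flat NON-cube `y`. [folklore] -/
def NFKummerHasUnit (b A₃ : ℤ) (a : ℕ) : Prop :=
  ∃ x y : ℚ_[3], OnNF b A₃ a x y ∧ x ≠ 0 ∧ (3 : ℤ) ∣ Padic.valuation y ∧ ¬ ∃ w : ℚ_[3], y = w ^ 3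

/-- `t = 0` (`k = 0`): every point with `x ≠ 0` has `y` a cube. [folklore] -/
def NFKummerTrivial (b A₃ : ℤ) (a : ℕ) : Prop :=
  ∀ x y : ℚ_[3], OnNF b A₃ a x y → x ≠ 0 → ∃ w : ℚ_[3], y = w ^ 3

/-- `t ∋` a très ramifié class: some point with `x ≠ 0` has `3 ∤ v₃(y)`. [folklore] -/
def NFKummerHasRamified (b A₃ : ℤ) (a : ℕ) : Prop :=
  ∃ x y : ℚ_[3], OnNF b A₃ a x y ∧ x ≠ 0 ∧ y ≠ 0 ∧ ¬ (3 : ℤ) ∣ Padic.valuation y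

/-- `t ⊆ ⟨[3ᵃA₃]⟩`: every `y` is `(3ᵃA₃)^e` times a cube (the line of the cell, Case S with `k = 1`). [folklore] -/
def NFKummerInLineOfA₃ (b A₃ : ℤ) (a : ℕ) : Prop :=
  ∀ x y : ℚ_[3], OnNF b A₃ a x y → x ≠ 0 →
    ∃ (e : ℕ) (w : ℚ_[3]), y = ((3 : ℚ_[3]) ^ a * (A₃ : ℚ_[3])) ^ e * w ^ 3

/-- **T30.4 `FlexNFCaseNKodairaLawThree` (v1) — ERRATUM ⟦cc-typer-5 GEN 16, (c28); located by n1011-p18 GEN 13 l.12353, o5-r2 l.12374 concurs⟧: FALSE AS TYPED for `v₃(b³ − A₃) ≥ 65`**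
(`cellN` reads the fuel `ord3 64`; witness `b = 1`, `A₃ = 1 − 3⁶⁵`: `cellN` ⇒ I*₆₁, curve I*₆₂ — a typing artefact, not a Tate slip; every P-K19 row has `v₃ ≤ 64`).  NEGATIVE EDGE =
`FlexNormalForm.not_flexNFCaseNKodairaLawThree` (n1011-p18, `O5/FlexNFCaseNTailThree.lean`, p333659 ACCEPTED); SUPERSEDED by `FlexNFCaseNKodairaValLawThree` (`O5/FlexNormalFormCaseNValLaw.lean`, true valuation via `cellNAt`); decl KEPT, `@[conjecture]` DROPPED, statement bytes unchanged.  (As typed: THEOREM-CANDIDATE, proof T30 §1 by Tate's algorithm on `nfT`; EVIDENCE P-K19.)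
For `b, A₃ ∈ ℤ` with `A₃ ≡ 1 (mod 3)` and `b³ ≠ A₃` the curve `y² + 3b·xy + A₃y = x³` has at `3` the Kodaira symbol and
the conductor exponent computed by `cellN b A₃` (and `v₃Δ = 3 + v₃(b³ − A₃)`, `c₃` as in `cellN` where determined).  Why it
might fail: only by a slip in the Tate run (each branch is a finite residue computation; census 0 exceptions in 17 cells).
[cite: SilvermanATAEC1994, IV.9.4 (Tate's algorithm)] [cite: DokchitserDokchitser2015LocalInvariantsIsogenous, Table 1 (arXiv:1208.5519 p. 3)]
[evidence: census cell O5, o5-r1 GEN 13, P-K19 kit j142073 (pre-registered gen13/P-K19-PREREG.md 29ea23ef8cc75c6f, frozen scorer 21d36208e1c08241): checks K19-a/a2/b/c/d on 314 800–343 472 Case-N/S rows, 0 exceptions; (Kodaira, c₃, v₃Δ, f₃) = cellN on every Case-N row — T30-FLAT-KUMMER-NORMAL-FORM.md §3] -/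
def FlexNFCaseNKodairaLawThree : Prop :=
  ∀ b A₃ : ℤ, A₃ % 3 = 1 → b ^ 3 ≠ A₃ →
    (nfQ b A₃ 0).kodairaSymbolAt (Additive.placeOf 3) = (cellN b A₃).kod ∧
      (nfQ b A₃ 0).conductorExponent (Additive.placeOf 3) = (cellN b A₃).f

/-- **T30.5 `FlexNFCaseSKodairaLawThree` — THEOREM: PROVED AS TYPED by n1011-p18 GEN 13, `FlexNormalForm.flexNFCaseSKodairaLawThree_holds` (`O5/FlexNFCaseSKodairaLawThreeProofs.lean`,
p332637 ACCEPTED 3b2137c47989; Tate's algorithm at 3 in the kernel, binders verbatim, axioms standard); `@[conjecture]` DROPPED ⟦cc-typer-5 GEN 16, (c28)⟧, statement bytes unchanged; census = EVIDENCE; a `_holds` closes no pair; O5 OPEN.**  (As typed: proof T30 §1; EVIDENCE P-K19.)  For `a ∈ {1, 2}`, `3 ∤ A₃`: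
`y² + 3b·xy + 3ᵃA₃·y = x³` is `3`-minimal of type IV (`a = 1`) / IV* (`a = 2`) with `c₃ = 3` and `(v₃Δ, f₃)` as in `cellS`.
Why it might fail: as above (finite residue computation; census 0 exceptions on 20 396 Case-S rows).
[cite: SilvermanATAEC1994, IV.9.4] [cite: GajovicRadicevicVerzobio2025, Lemmas 52–53 and Thm. 55 (arXiv:2502.08583 pp. 20–21)]
[evidence: census cell O5, o5-r1 GEN 13, P-K19 kit j142073: K19-h0/K19-h 20 396/20 396 Case-S rows in the predicted (Kodaira, c₃, v₃Δ, f₃) cell, 0 exceptions] -/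
def FlexNFCaseSKodairaLawThree : Prop :=
  ∀ (a : ℕ) (b A₃ : ℤ), (a = 1 ∨ a = 2) → ¬ (3 : ℤ) ∣ A₃ →
    (nfQ b A₃ a).kodairaSymbolAt (Additive.placeOf 3) = (cellS a b).kod ∧
      (nfQ b A₃ a).conductorExponent (Additive.placeOf 3) = (cellS a b).f

/-- **T30.2/T30.3 + A1 `FlexNFCaseNKummerLawThree` — THEOREM: PROVED AS TYPED by n1011-p18 GEN 16, `FlexNormalForm.flexNFCaseNKummerLawThree_holds` (`O5/FlexNFCaseNKummerLawThreeProofs.lean`, p345238 ACCEPTED; unit half `O5/FlexNFCaseNKummerUnitThree.lean` p342951; binders verbatim, axioms standard); `@[conjecture]` DROPPED ⟦cc-typer-5 GEN 18, rider (r9) of cc-lead ⟦gen71⟧ (2′) / n1011 lead R5-174⟧, statement bytes unchanged; census = EVIDENCE; a `_holds` closes no pair; O5 OPEN.**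
**(As typed: THEOREM-CANDIDATE, proof T30 §1: Lemma 0, `E = 3E + E⁰` when `3 ∤ c₃`,
the cusp expansion `eqnValue_nf_cusp` when `c₃ = 3`; EVIDENCE P-K19).**  In Case N the Kummer image `t = δ_φ̂(E(ℚ₃))` is
FLAT, and it is the unit line `U` exactly when `cellN` says `k = 1` (`a₉ ≠ 1`, or the IV cell with `c₃ = 3`), trivial when
`k = 0`.  The flat half and the unit half for `a₉ ≠ 1` are Lean-proved modulo assembly (tree p308301 END-3/END-4 and the banked
`ThreeTorsionNormalFormValuation.lean`, x11b3-p7; `exists_point_not_cube_of_emod_nine` below); the `k = 0` half and the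
IV-`c₃ = 3` cell use the group law.  Why it might fail: the `k = 0` half through a non-`E⁰` point in an `Iₙ*` cell with `4 ∣ c`
(excluded by `E = 3E + E⁰`; census 216 173/216 173).
[cite: Schaefer1996, Lemma 3.8] [cite: CohenPazuki2009ThreeDescent, Def. 1.3 and Prop. 2.2 (arXiv:0903.4963 pp. 4–5)]
[evidence: census cell O5, o5-r1 GEN 13, P-K19 kit j142073: (k, t) = (cellN.k, cellN.t) on 323 076/323 076 Case-N rows (K19-b/c), t flat on all of them, III ⇒ (1,U) 27 224/27 224 (K19-e); hash-split FIT 171 408 / VAL 172 064, 0 exceptions] -/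
def FlexNFCaseNKummerLawThree : Prop :=
  ∀ b A₃ : ℤ, A₃ % 3 = 1 → b ^ 3 ≠ A₃ →
    NFKummerFlat b A₃ 0 ∧
      ((cellN b A₃).k = 1 → NFKummerHasUnit b A₃ 0) ∧ ((cellN b A₃).k = 0 → NFKummerTrivial b A₃ 0)

/-- **T30.6 `FlexNFCaseSKummerLawThree` (v1) — ERRATUM ⟦cc-typer-5 GEN 17, (c30b); located by n1011-p18 GEN 14 l.12750, n1011 lead l.12767 / o5-r1 (author) l.12786 / typer l.12799 concur⟧: FALSE AS TYPED on `A₃ ≡ 2 (mod 3)`** (the sign normalisation of T30.1 (f) — `u = −1`, `(b, A₃) ↦ (−b, −A₃)`, unit part of `A₃ ≡ 1 (mod 3)` — is stated in T30 §1 and applied by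
the census block, but was not typed: the node binds only `¬ 3 ∣ A₃` and reads `cellS a b`, whose `a = 1` `k`-column is not `b ↦ −b` symmetric; witness `(a, b, A₃) = (1, 2, 2)`, the unit point `(ξ, 4)` on `y² + 6xy + 6y = x³` — a typing slip, not a slip of T30.6).  NEGATIVE EDGE = `FlexNormalForm.not_flexNFCaseSKummerLawThree` (n1011-p18,
`O5/FlexNFCaseSKummerLawThreeSign.lean`, p338343 ACCEPTED); SUPERSEDED by `FlexNFCaseSKummerSignedLawThree` (`O5/FlexNormalFormCaseSSignedLaw.lean`, p336580: binder `A₃ % 3 = 1`, any-sign reading PROVED there as `kummerLawS_of_signed`); decl KEPT, `@[conjecture]` DROPPED, statement bytes unchanged.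
(As typed: THEOREM-CANDIDATE, proof T30 §1 (Case S: `y(Q) ≡ ±1 + 3(b+1)` resp. `±1 + 3b (mod 9)`
on the non-identity components); EVIDENCE P-K19.)  In Case S the image always contains the très ramifié class `[3ᵃA₃] = δ(P₀)⁻¹`;
it is the LINE `⟨[3ᵃA₃]⟩` when `cellS` says `k = 1` and the whole plane when `k = 2`.  Why it might fail: a component point with
`y` a cube times `[3ᵃA₃]^e` in a `k = 2` cell (census: none in 14 157 rows).
[cite: GajovicRadicevicVerzobio2025, Thm. 55 (arXiv:2502.08583 p. 21)] [cite: BKLS2019ThreeIsogenySelmer, Thm. 10.5 (arXiv:1709.09790 p. 15)]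
[evidence: census cell O5, o5-r1 GEN 13, P-K19 kit j142073: K19-h 20 396/20 396 Case-S rows have (k, t) = (cellS.k, cellS.t) with t ∋ [3ᵃA₃]; cells IV v₃Δ=6 (1,L) 2 659, (2,P) 2 665; IV v₃Δ=7 (2,P) 2 412; IV* v₃Δ=11 (1,L) 3 580; IV* v₃Δ=9 (2,P) 9 080] -/
def FlexNFCaseSKummerLawThree : Prop :=
  ∀ (a : ℕ) (b A₃ : ℤ), (a = 1 ∨ a = 2) → ¬ (3 : ℤ) ∣ A₃ →
    NFKummerHasRamified b A₃ a ∧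
      ((cellS a b).k = 1 → NFKummerInLineOfA₃ b A₃ a) ∧ ((cellS a b).k = 2 → NFKummerHasUnit b A₃ a)

/-- **T29.6 in normal form `FlexNFTypeIIIFlatUnitThree` — THEOREM: PROVED AS TYPED by n1011-p18 GEN 14, `flexNFTypeIIIFlatUnitThree_holds` (`O5/FlexNFTypeIIIFlatUnitThreeProofs.lean`, p337515 ACCEPTED; type III ⇒ `A₃ ≢ 1 (mod 9)` by the Case-N Kodaira cells `O5/FlexNFCaseNKodairaCellsThree.lean` + the tail p333659, then §T's `nfKummer_flatUnit_of_emod_nine`;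
binders verbatim, axioms standard); `@[conjecture]` DROPPED ⟦cc-typer-5 GEN 17, rider (r1)⟧, statement bytes unchanged; census = EVIDENCE; a `_holds` closes no pair; O5 OPEN.**  (As typed: GEN 12's EVIDENCE law, a consequence of the two Case-N nodes: `typeIII_flatUnit_of_laws`.)  A Case-N flex normal form of Kodaira type III at `3` has Kummer image exactly the
flat line.
[cite: DokchitserDokchitser2015LocalInvariantsIsogenous, Lemma 10 (arXiv:1208.5519 p. 7)]
[evidence: census cell O5, o5-r1 GEN 13, P-K19 kit j142073: 27 224/27 224 class-01 type-III curves (N < 500 000, 9 ∣ N) have (k,t) = (1,U); GEN 12 P-K18 j141165: 2 251/2 251] -/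
def FlexNFTypeIIIFlatUnitThree : Prop :=
  ∀ b A₃ : ℤ, A₃ % 3 = 1 → b ^ 3 ≠ A₃ →
    (nfQ b A₃ 0).kodairaSymbolAt (Additive.placeOf 3) = .III → NFKummerFlat b A₃ 0 ∧ NFKummerHasUnit b A₃ 0

/-- PROVED bookkeeping: T29.6 (normal form) follows from the Kodaira law and the Kummer law of Case N.  (ERRATUM note (c28): `hK` is the REFUTED v1 node; the re-pointed version over the v2 node is `typeIII_flatUnit_of_valLaws` in `O5/FlexNormalFormCaseNValLaw.lean`.) [folklore] -/
theorem typeIII_flatUnit_of_laws (hK : FlexNFCaseNKodairaLawThree) (hU : FlexNFCaseNKummerLawThree) :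
    FlexNFTypeIIIFlatUnitThree := by
  intro b A₃ h₁ hΔ hIII
  obtain ⟨hkod, -⟩ := hK b A₃ h₁ hΔ
  obtain ⟨hflat, hunit, -⟩ := hU b A₃ h₁ hΔ
  rw [hkod] at hIII
  exact ⟨hflat, hunit (cellN_k_of_kod_eq_III b A₃ hIII).1⟩

/-- **PROVED (from the tree's p308301): the unit half of T30.3 for `a₉ ∉ {1, 8}`.**  If `A₃ ≡ 1 (mod 3)` and
`A₃ ≢ 1 (mod 9)` then `y² + 3b·xy + A₃y = x³` has a `ℚ₃`-point with `x ≠ 0` whose `y` is NOT a cube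
(`ThreeTorsionNormalForm.exists_point_not_cube` + `not_exists_pow_three_eq_of_sq_ne_one`). [folklore] -/
theorem exists_point_not_cube_of_emod_nine (b A₃ : ℤ) (h₁ : A₃ % 3 = 1) (h₉ : A₃ % 9 ≠ 1) :
    ∃ x y : ℚ_[3], OnNF b A₃ 0 x y ∧ x ≠ 0 ∧ ¬ ∃ w : ℚ_[3], y = w ^ 3 := by
  have h3 : ¬ (3 : ℤ) ∣ A₃ := by omega
  have ha₃ : ‖((A₃ : ℤ) : ℚ_[3])‖ = 1 := by
    refine le_antisymm (Padic.norm_int_le_one _) (not_lt.1 fun h => h3 ?_)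
    exact_mod_cast (Padic.norm_intCast_lt_one_iff.1 h)
  have ha₁ : ‖(3 * (b : ℚ_[3]))‖ < 1 := by
    have e : ((3 * b : ℤ) : ℚ_[3]) = 3 * (b : ℚ_[3]) := by push_cast; ring
    rw [← e, Padic.norm_intCast_lt_one_iff]
    exact ⟨b, by push_cast; ring⟩
  have hA : ‖((A₃ : ℤ_[3]))‖ = 1 := by
    rw [PadicInt.norm_def, PadicInt.coe_intCast]; exact ha₃
  have hres : (PadicInt.toZModPow 2 (A₃ : ℤ_[3])) ^ 2 ≠ 1 := by
    rw [map_intCast]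
    have h47 : A₃ % 9 = 4 ∨ A₃ % 9 = 7 := by omega
    rcases h47 with h | h
    · have e : ((A₃ : ℤ) : ZMod (3 ^ 2)) = ((4 : ℤ) : ZMod (3 ^ 2)) :=
        (ZMod.intCast_eq_intCast_iff' A₃ 4 (3 ^ 2)).2 (by norm_num [h])
      rw [e]; decide
    · have e : ((A₃ : ℤ) : ZMod (3 ^ 2)) = ((7 : ℤ) : ZMod (3 ^ 2)) :=
        (ZMod.intCast_eq_intCast_iff' A₃ 7 (3 ^ 2)).2 (by norm_num [h])
      rw [e]; decide
  have hnc : ¬ ∃ w : ℚ_[3], ((A₃ : ℤ) : ℚ_[3]) = w ^ 3 := by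
    have := ThreeTorsionNormalForm.not_exists_pow_three_eq_of_sq_ne_one hA hres
    simpa [PadicInt.coe_intCast] using this
  obtain ⟨x, y, hxy, hx, hy⟩ := ThreeTorsionNormalForm.exists_point_not_cube ha₃ ha₁ hnc
  exact ⟨x, y, by simpa [OnNF] using hxy, hx, hy⟩

/-! ## §T Typer appendix (cc-typer-5 GEN 10; OUTSIDE o5-r1's frozen text): the link to FILE V asked in A-O5-28 -/

/-- **PROVED (from the tree's FILE V, x11b3-p7 GEN 15 p309383): the FLAT half of T30.2 in Case N** — for every `b ∈ ℤ` and every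
`A₃ ∈ ℤ` prime to `3`, every `ℚ₃`-point of `y² + 3b·xy + A₃y = x³` with `x ≠ 0` has `y ≠ 0` and `3 ∣ v₃(y)`
(`ThreeTorsionNormalForm.ne_zero_and_three_dvd_valuation` with `a₁ = 3b`, `a₃ = A₃`: `‖a₃‖ = 1`, `‖a₁‖ ≤ 1`). [folklore] -/
theorem nfKummerFlat_zero (b A₃ : ℤ) (h3 : ¬ (3 : ℤ) ∣ A₃) : NFKummerFlat b A₃ 0 := by
  intro x y hxy hx
  have ha₃ : ‖((A₃ : ℤ) : ℚ_[3])‖ = 1 := by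
    refine le_antisymm (Padic.norm_int_le_one _) (not_lt.1 fun h => h3 ?_)
    exact_mod_cast (Padic.norm_intCast_lt_one_iff.1 h)
  have ha₁ : ‖(3 * (b : ℚ_[3]))‖ ≤ 1 := by
    have e : ((3 * b : ℤ) : ℚ_[3]) = 3 * (b : ℚ_[3]) := by push_cast; ring
    rw [← e]; exact Padic.norm_int_le_one _
  have h' : y ^ 2 + 3 * (b : ℚ_[3]) * x * y + ((A₃ : ℤ) : ℚ_[3]) * y = x ^ 3 := by
    simpa [OnNF] using hxy
  exact ThreeTorsionNormalForm.ne_zero_and_three_dvd_valuation ha₃ ha₁ h' hx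

/-- **PROVED: the unit class is FLAT** — for `A₃ ≡ 1 (mod 3)`, `A₃ ≢ 1 (mod 9)` the normal form has a point with `x ≠ 0` whose
`y` is a flat non-cube (`exists_point_not_cube_of_emod_nine` + `nfKummerFlat_zero`). [folklore] -/
theorem nfKummerHasUnit_zero_of_emod_nine (b A₃ : ℤ) (h₁ : A₃ % 3 = 1) (h₉ : A₃ % 9 ≠ 1) :
    NFKummerHasUnit b A₃ 0 := by
  obtain ⟨x, y, hxy, hx, hy⟩ := exists_point_not_cube_of_emod_nine b A₃ h₁ h₉
  have h3 : ¬ (3 : ℤ) ∣ A₃ := by omega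
  exact ⟨x, y, hxy, hx, (nfKummerFlat_zero b A₃ h3 x y hxy hx).2, hy⟩

/-- **PROVED CELL LAW `(k, t) ⊇ (1, U)` on every Case-N cell with `a₉ ≠ 1`** (type III, II `v₃Δ = 3` `(1,U)`, II `v₃Δ = 4` in
`cellN`'s table): the Kummer image is flat and contains a unit class — the conclusion of `FlexNFTypeIIIFlatUnitThree`, with the
Kodaira hypothesis replaced by the residue condition that (granted T30.4) characterises those cells. [folklore] -/
theorem nfKummer_flatUnit_of_emod_nine (b A₃ : ℤ) (h₁ : A₃ % 3 = 1) (h₉ : A₃ % 9 ≠ 1) :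
    NFKummerFlat b A₃ 0 ∧ NFKummerHasUnit b A₃ 0 :=
  ⟨nfKummerFlat_zero b A₃ (by omega), nfKummerHasUnit_zero_of_emod_nine b A₃ h₁ h₉⟩

end Law

end Summit.BirchSwinnertonDyer.Rank1Residual.O5.FlexNormalForm
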